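import Summits.ValiantsHypothesis.ValiantsHypothesis.Theorems.LangWeilTransferTameResolutionSizeCalculus

/-!
# LangWeilTransfer, support item `TameResolution` (stmt-ValiantsHypothesis-6378) — sizes under the
# integer specialisations `α ↦ a` and `Λ ↦ c`

Route `LangWeilTransfer` of `ValiantsHypothesis` (conditional route; honest framing: bookkeeping,
nothing here bears on VP ≠ VNP). Quantitative pass (roadmap note of val-lit-p6 g9, §1(B)): the
two specialisations of `exists_parametrisation_explicit`,
`σ_a : ℤ[T ⊔ Λ ⊔ α] → ℤ[T][Λ]` (`α ↦ a ∈ ℕ^{n×t}`) and `sp_c : ℤ[T][Λ] → ℤ[T]` (`Λ ↦ c ∈ ℕⁿ`),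
are — after flattening `ℤ[T][Λ] ≅ ℤ[Λ ⊔ T]` by `(sumAlgEquiv ℤ (Fin n) (Fin r)).symm` — evaluations
`aeval g` with `g_v ∈ {variables} ∪ {constants ≤ N}`, so `LangWeilTransferTameResolutionSizeCalculus`
bounds total degrees (no increase) and weights (factor `N^{deg}`).

* `flat_comp_specA`, `totalDegree_specA_le`, `weight_specA_le` — for `σ_a`;
* `specC_comp_unflat`, `totalDegree_specC_le`, `weight_specC_le` — for `sp_c` (stated on the flat
  ring `ℤ[Λ ⊔ T]` through `sumAlgEquiv`).
-/

noncomputable section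

open MvPolynomial
open Literature.Computability.AlgebraicComplexity

-- the summit and the problem share the name `ValiantsHypothesis` (D-0017 single-conjunct layout)
set_option linter.dupNamespace false

namespace Summit.ValiantsHypothesis.ValiantsHypothesis.Theorems.LangWeilTransfer

variable {r n t : ℕ}

/-- The specialisation `σ_a` followed by flattening is the substitution
`T_k ↦ X (inr k)`, `Λ_j ↦ X (inl j)`, `α_p ↦ a_p`. -/
theorem flat_comp_specA (a : Fin n × Fin t → ℕ) :
    let ι := Fin r ⊕ (Fin n ⊕ (Fin n × Fin t))
    let σa : MvPolynomial ι ℤ →+* MvPolynomial (Fin n) (MvPolynomial (Fin r) ℤ) :=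
      eval₂Hom (C.comp C) (Sum.elim (fun k => C (X k)) (Sum.elim (fun j => X j) (fun p => C (C ((a p : ℕ) : ℤ)))))
    let g : ι → MvPolynomial (Fin n ⊕ Fin r) ℤ :=
      Sum.elim (fun k => X (Sum.inr k)) (Sum.elim (fun j => X (Sum.inl j)) (fun p => C ((a p : ℕ) : ℤ)))
    ((sumAlgEquiv ℤ (Fin n) (Fin r)).symm.toRingEquiv.toRingHom.comp σa) =
      (aeval g : MvPolynomial ι ℤ →ₐ[ℤ] MvPolynomial (Fin n ⊕ Fin r) ℤ).toRingHom := by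
  intro ι σa g
  refine MvPolynomial.ringHom_ext (fun z => ?_) (fun v => ?_)
  · simp only [eq_intCast, map_intCast]
  · rcases v with k | j | p
    · simp only [σa, g, RingHom.comp_apply, eval₂Hom_X', Sum.elim_inl, RingEquiv.toRingHom_eq_coe,
        AlgEquiv.toRingEquiv_toRingHom, RingHom.coe_coe, sumAlgEquiv_symm_C_X, AlgHom.toRingHom_eq_coe, aeval_X]
    · simp only [σa, g, RingHom.comp_apply, eval₂Hom_X', Sum.elim_inr, Sum.elim_inl, RingEquiv.toRingHom_eq_coe,
        AlgEquiv.toRingEquiv_toRingHom, RingHom.coe_coe, sumAlgEquiv_symm_X, AlgHom.toRingHom_eq_coe, aeval_X]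
    · simp only [σa, g, RingHom.comp_apply, eval₂Hom_X', Sum.elim_inr, RingEquiv.toRingHom_eq_coe,
        AlgEquiv.toRingEquiv_toRingHom, RingHom.coe_coe, map_natCast, AlgHom.toRingHom_eq_coe, aeval_X]

/-- **`σ_a` does not increase the total degree** (after flattening). -/
theorem totalDegree_specA_le (a : Fin n × Fin t → ℕ) (f : MvPolynomial (Fin r ⊕ (Fin n ⊕ (Fin n × Fin t))) ℤ) :
    let ι := Fin r ⊕ (Fin n ⊕ (Fin n × Fin t))
    let σa : MvPolynomial ι ℤ →+* MvPolynomial (Fin n) (MvPolynomial (Fin r) ℤ) :=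
      eval₂Hom (C.comp C) (Sum.elim (fun k => C (X k)) (Sum.elim (fun j => X j) (fun p => C (C ((a p : ℕ) : ℤ)))))
    ((sumAlgEquiv ℤ (Fin n) (Fin r)).symm (σa f)).totalDegree ≤ f.totalDegree := by
  intro ι σa
  have h := congrArg (fun φ => φ f) (flat_comp_specA (r := r) a)
  simp only [RingHom.comp_apply, RingEquiv.toRingHom_eq_coe,
    AlgEquiv.toRingEquiv_toRingHom, RingHom.coe_coe, AlgHom.toRingHom_eq_coe] at h
  change ((sumAlgEquiv ℤ (Fin n) (Fin r)).symm (σa f)).totalDegree ≤ f.totalDegree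
  rw [h]
  refine (totalDegree_aeval_le_mul _ (e := 1) (fun v => ?_) f).trans (by rw [one_mul])
  rcases v with k | j | p
  · simp only [Sum.elim_inl, totalDegree_X]; exact le_rfl
  · simp only [Sum.elim_inr, Sum.elim_inl, totalDegree_X]; exact le_rfl
  · simp only [Sum.elim_inr]
    rw [show (C ((a p : ℕ) : ℤ) : MvPolynomial (Fin n ⊕ Fin r) ℤ) = C ((a p : ℕ) : ℤ) from rfl, totalDegree_C]
    exact Nat.zero_le _

/-- **`σ_a` multiplies weights by at most `N^{deg}`** (after flattening), if `a ≤ N`, `1 ≤ N`. -/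
theorem weight_specA_le (a : Fin n × Fin t → ℕ) {N : ℕ} (hN : 1 ≤ N) (ha : ∀ p, a p ≤ N)
    (f : MvPolynomial (Fin r ⊕ (Fin n ⊕ (Fin n × Fin t))) ℤ) :
    let ι := Fin r ⊕ (Fin n ⊕ (Fin n × Fin t))
    let σa : MvPolynomial ι ℤ →+* MvPolynomial (Fin n) (MvPolynomial (Fin r) ℤ) :=
      eval₂Hom (C.comp C) (Sum.elim (fun k => C (X k)) (Sum.elim (fun j => X j) (fun p => C (C ((a p : ℕ) : ℤ)))))
    weight ((sumAlgEquiv ℤ (Fin n) (Fin r)).symm (σa f)) ≤ weight f * N ^ f.totalDegree := by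
  intro ι σa
  have h := congrArg (fun φ => φ f) (flat_comp_specA (r := r) a)
  simp only [RingHom.comp_apply, RingEquiv.toRingHom_eq_coe,
    AlgEquiv.toRingEquiv_toRingHom, RingHom.coe_coe, AlgHom.toRingHom_eq_coe] at h
  change weight ((sumAlgEquiv ℤ (Fin n) (Fin r)).symm (σa f)) ≤ _
  rw [h]
  refine weight_aeval_le_mul_pow _ hN (fun v => ?_) f
  have hX : ∀ w : Fin n ⊕ Fin r, weight (X w : MvPolynomial (Fin n ⊕ Fin r) ℤ) ≤ N := fun w => by
    rw [show (X w : MvPolynomial (Fin n ⊕ Fin r) ℤ) = monomial (Finsupp.single w 1) 1 from rfl, weight_monomial]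
    exact hN
  rcases v with k | j | p
  · exact hX _
  · exact hX _
  · simp only [Sum.elim_inr]
    rw [weight_C, Int.natAbs_natCast]
    exact ha p

/-- The specialisation `Λ ↦ c` composed with un-flattening is the substitution
`X (inl j) ↦ c_j`, `X (inr k) ↦ T_k`. -/
theorem specC_comp_unflat (c : Fin n → ℕ) :
    let sp : MvPolynomial (Fin n) (MvPolynomial (Fin r) ℤ) →+* MvPolynomial (Fin r) ℤ :=
      eval fun j => ((c j : ℕ) : MvPolynomial (Fin r) ℤ)
    let g : Fin n ⊕ Fin r → MvPolynomial (Fin r) ℤ := Sum.elim (fun j => C ((c j : ℕ) : ℤ)) (fun k => X k)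
    sp.comp (sumAlgEquiv ℤ (Fin n) (Fin r)).toRingEquiv.toRingHom =
      (aeval g : MvPolynomial (Fin n ⊕ Fin r) ℤ →ₐ[ℤ] MvPolynomial (Fin r) ℤ).toRingHom := by
  intro sp g
  refine MvPolynomial.ringHom_ext (fun z => ?_) (fun v => ?_)
  · simp only [eq_intCast, map_intCast]
  · rcases v with j | k
    · simp only [sp, g, RingHom.comp_apply, RingEquiv.toRingHom_eq_coe,
        AlgEquiv.toRingEquiv_toRingHom, RingHom.coe_coe, sumAlgEquiv_X_inl, eval_X, Sum.elim_inl,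
        AlgHom.toRingHom_eq_coe, aeval_X, map_natCast]
    · simp only [sp, g, RingHom.comp_apply, RingEquiv.toRingHom_eq_coe,
        AlgEquiv.toRingEquiv_toRingHom, RingHom.coe_coe, sumAlgEquiv_X_inr, eval_C, Sum.elim_inr,
        AlgHom.toRingHom_eq_coe, aeval_X]

/-- **`Λ ↦ c` does not increase the total degree**: for `f ∈ ℤ[Λ ⊔ T]` (the flattening of an
element of `ℤ[T][Λ]`), `deg (sp_c (unflat f)) ≤ deg f`. -/
theorem totalDegree_specC_le (c : Fin n → ℕ) (f : MvPolynomial (Fin n ⊕ Fin r) ℤ) :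
    let sp : MvPolynomial (Fin n) (MvPolynomial (Fin r) ℤ) →+* MvPolynomial (Fin r) ℤ :=
      eval fun j => ((c j : ℕ) : MvPolynomial (Fin r) ℤ)
    (sp (sumAlgEquiv ℤ (Fin n) (Fin r) f)).totalDegree ≤ f.totalDegree := by
  intro sp
  have h := congrArg (fun φ => φ f) (specC_comp_unflat (r := r) c)
  simp only [RingHom.comp_apply, RingEquiv.toRingHom_eq_coe,
    AlgEquiv.toRingEquiv_toRingHom, RingHom.coe_coe, AlgHom.toRingHom_eq_coe] at h
  change (sp (sumAlgEquiv ℤ (Fin n) (Fin r) f)).totalDegree ≤ f.totalDegree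
  rw [h]
  refine (totalDegree_aeval_le_mul _ (e := 1) (fun v => ?_) f).trans (by rw [one_mul])
  rcases v with j | k
  · simp only [Sum.elim_inl, totalDegree_C]; exact Nat.zero_le _
  · simp only [Sum.elim_inr, totalDegree_X]; exact le_rfl

/-- **`Λ ↦ c` multiplies weights by at most `N^{deg}`**, if `c ≤ N`, `1 ≤ N`. -/
theorem weight_specC_le (c : Fin n → ℕ) {N : ℕ} (hN : 1 ≤ N) (hc : ∀ j, c j ≤ N)
    (f : MvPolynomial (Fin n ⊕ Fin r) ℤ) :
    let sp : MvPolynomial (Fin n) (MvPolynomial (Fin r) ℤ) →+* MvPolynomial (Fin r) ℤ :=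
      eval fun j => ((c j : ℕ) : MvPolynomial (Fin r) ℤ)
    weight (sp (sumAlgEquiv ℤ (Fin n) (Fin r) f)) ≤ weight f * N ^ f.totalDegree := by
  intro sp
  have h := congrArg (fun φ => φ f) (specC_comp_unflat (r := r) c)
  simp only [RingHom.comp_apply, RingEquiv.toRingHom_eq_coe,
    AlgEquiv.toRingEquiv_toRingHom, RingHom.coe_coe, AlgHom.toRingHom_eq_coe] at h
  change weight (sp (sumAlgEquiv ℤ (Fin n) (Fin r) f)) ≤ _
  rw [h]
  refine weight_aeval_le_mul_pow _ hN (fun v => ?_) f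
  rcases v with j | k
  · simp only [Sum.elim_inl]
    rw [weight_C, Int.natAbs_natCast]
    exact hc j
  · simp only [Sum.elim_inr]
    rw [show (X k : MvPolynomial (Fin r) ℤ) = monomial (Finsupp.single k 1) 1 from rfl, weight_monomial]
    exact hN

end Summit.ValiantsHypothesis.ValiantsHypothesis.Theorems.LangWeilTransfer
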